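import Literature.Computability.Cryptography.FGComplexity
import Literature.Computability.Cryptography.WordRAMProofs
import Literature.Computability.Cryptography.WordRAMExec
import Literature.Computability.Cryptography.WordRAMInline3
import HarnessLib

/-!
# Fine-grained complexity on the word RAM — discharged facts

Proofs of named facts stated in `Literature.Computability.Cryptography.FGComplexity` (kept in a
sibling file so that the statement file stays a definitions/named-facts file):

* `FGProblem.InTime.randInTime_holds` discharges `FGProblem.InTime.randInTime` (a deterministic
  algorithm is a randomised algorithm with success probability `1 ≥ 2/3`), via
  `WordRAM.successProb_eq_one_iff_of_isDeterministic_holds`;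
* `FGProblem.InTimeO.randInTimeO_holds` and `FGProblem.TrulySubTime.randTrulySubTime_holds`
  discharge the `O(·)` and truly-sub-`n^c` versions;
* `FGReducible.refl_of_budget`: reflexivity of fine-grained reducibility (the one-query
  self-reduction `WordRAM.queryInput`) for well-formed problems whose time budget `a(n)` never lies
  strictly between `0` and `1` — in particular for every budget `n ^ α`, `α ≥ 0`
  (`FGReducible.refl_rpow`, `FGEquivalent.refl_rpow`, `SubcubicEquivalent.refl`,
  `SubquadraticEquivalent.refl`). The named fact `FGReducible.refl` (all budgets) additionally
  needs a finite lookup table for the instances with `0 < a(n) < 1` (on which a query of ledger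
  cost `a(n)^{1-ε}`, `ε > 1`, is unaffordable) and is not discharged here.

* `FGReducible.trulySubTime_of_sizeFitsWord_holds` discharges the corrected transfer property
  `FGReducible.trulySubTime_of_sizeFitsWord` (VVW ICM 2018, the remark after Def. 2.1: a
  fine-grained reduction `(A, n^α) ≤_FG (B, n^β)` transfers truly sub-`n^β` algorithms for `B`
  to truly sub-`n^α` algorithms for `A`, for well-formed problems whose size fits in a word).
  The algorithm is the verified simulating machine `WordRAM.Inline.SIM` of
  `Literature.Computability.Cryptography.WordRAMInline3` (the reduction run at a larger word
  size with relocated memory and emulated arithmetic, every oracle query answered by an inline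
  run of `B`'s algorithm at the query's own word size); this file supplies the oracle computed
  by an algorithm (`exists_oracle_of_algorithm`), the numeric side conditions of the simulation
  for an explicit word-size constant (`sim_numerics`), the per-instance cost bound
  (`sim_instance`) and the exponent bookkeeping (`exists_size_le_rpow`: the bit size is
  sub-polynomial; `exists_subExponent`; `sim_cost_le_linear`); the unconditional forms of its
  same-file dependents follow (`FGReducible.transfer_trulySubTime`,
  `FGReducible.trulySubTime'_of_sizeFitsWord_holds` — the unconditional corrected form of the
  primed restatement `FGReducible.trulySubTime'`, which is misstated along with
  `FGReducible.trulySubTime` —, `SubcubicEquivalent.trulySubTime_iff_of_sizeFitsWord_holds`,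
  `SubquadraticEquivalent.trulySubTime_iff_of_sizeFitsWord_holds`,
  `trulySubTime_iff_of_family_of_sizeFitsWord_holds`).

* `FGProblem.RandInTimeInst.mono`, `RandInTime.mono`, `RandInTime.randInTimeO`, `RandInTimeO.mono`,
  `RandTrulySubTime.mono` (and `RandInTimeInst.of_le`, `.restrict`, `RandInTimeO.restrict`): the
  randomised running-time predicates are monotone in the time bound, from
  `WordRAM.successProb_mono_steps`.

The structural fact `FGReducible.trans` (VVW ICM 2018, Prop. 2.2) additionally needs query
forwarding in the inline simulation and is not discharged here.

## References

* V. Vassilevska Williams, *On some fine-grained questions in algorithms and complexity*,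
  Proc. ICM 2018, §2 (deterministic vs. randomised word-RAM algorithms).
-/

namespace Literature.Computability.Cryptography

open WordRAM

namespace FGProblem

/-- Discharges `InTime.randInTime`: a deterministic time-`T` algorithm is a randomised time-`T`
algorithm with success probability `1 ≥ 2/3` (VVW ICM 2018, §2). [cite: ICM2018, §2] -/
theorem InTime.randInTime_holds : InTime.randInTime := by
  intro P T h
  obtain ⟨M, k, hd, ho, hM⟩ := h
  refine ⟨M, k, ho, fun a => ?_⟩
  rw [(successProb_eq_one_iff_of_isDeterministic_holds hd _ _ _ _ _).2 (hM a)]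
  norm_num

/-- Discharges `InTimeO.randInTimeO`: `InTimeO t` implies `RandInTimeO t`. [folklore] -/
theorem InTimeO.randInTimeO_holds : InTimeO.randInTimeO := by
  intro P t h
  obtain ⟨C, hC⟩ := h
  exact ⟨C, InTime.randInTime_holds hC⟩

/-- Discharges `TrulySubTime.randTrulySubTime`: a truly sub-`n^c` deterministic algorithm is a
truly sub-`n^c` randomised one. [folklore] -/
theorem TrulySubTime.randTrulySubTime_holds : TrulySubTime.randTrulySubTime := by
  intro P c h
  obtain ⟨ε, hε, hP⟩ := h
  exact ⟨ε, hε, InTimeO.randInTimeO_holds hP⟩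

/-- A deterministic time bound yields the randomised one (applied form of
`InTime.randInTime_holds`). [folklore] -/
theorem InTime.randInTime' {P : FGProblem} {T : ℕ → ℝ} (h : P.InTime T) : P.RandInTime T :=
  InTime.randInTime_holds h

/-- Applied form of `InTimeO.randInTimeO_holds`. [folklore] -/
theorem InTimeO.randInTimeO' {P : FGProblem} {t : ℕ → ℝ} (h : P.InTimeO t) : P.RandInTimeO t :=
  InTimeO.randInTimeO_holds h

/-- Applied form of `TrulySubTime.randTrulySubTime_holds`. [folklore] -/
theorem TrulySubTime.randTrulySubTime' {P : FGProblem} {c : ℝ} (h : P.TrulySubTime c) :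
    P.RandTrulySubTime c :=
  TrulySubTime.randTrulySubTime_holds h

end FGProblem

/-! ## Reflexivity of fine-grained reducibility (VVW ICM 2018, §2) -/

/-- Monotonicity of real powers in the exponent, in the form needed for fine-grained ledgers:
if the base is `0` or at least `1` then `a ^ e₁ ≤ a ^ e₂ + 1` whenever `e₁ ≤ e₂` (for `a ≥ 1`
this is `Real.rpow_le_rpow_of_exponent_le`; for `a = 0` both sides are `0` or `1`). [folklore] -/
theorem rpow_le_rpow_add_one_of_zero_or_one_le {a e₁ e₂ : ℝ} (ha : a = 0 ∨ 1 ≤ a)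
    (he : e₁ ≤ e₂) : a ^ e₁ ≤ a ^ e₂ + 1 := by
  rcases ha with rfl | h1
  · have h2 : (0 : ℝ) ≤ (0 : ℝ) ^ e₂ := Real.rpow_nonneg le_rfl _
    rcases eq_or_ne e₁ 0 with rfl | h
    · rw [Real.rpow_zero]; linarith
    · rw [Real.zero_rpow h]; linarith
  · linarith [Real.rpow_le_rpow_of_exponent_le h1 he]

/-- **Reflexivity of fine-grained reducibility** for well-formed problems whose budget avoids
`(0, 1)`: `(A, a) ≤_FG (A, a)` by the one-query self-reduction `WordRAM.queryInput` (query the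
oracle on the input, output its answer). Given `ε`, take `δ := min ε η` with `η` from
`IsStandard.length_le`; the query costs `a(n)^{1-ε} ≤ a(n)^{1-δ} + 1` in the ledger and
`|encode x| ≤ C_L a(n)^{1-η} + C_L ≤ C_L a(n)^{1-δ} + 2 C_L` in the length charge, the run takes
`2` steps, and the answer is stored exactly because the word size `max k_O 1 · width x` dominates
both the input width and the output width `k_O · width x` of `HasWordOutputs`.
VVW ICM 2018, §2 (fine-grained reducibility is a preorder). [cite: VassilevskaWilliamsICM2018, §2] -/
theorem FGReducible.refl_of_budget {A : FGProblem} {a : ℕ → ℝ}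
    (hA : A.IsStandard a) (ha : ∀ n, a n = 0 ∨ 1 ≤ a n) : FGReducible A a A a := by
  intro ε hε
  obtain ⟨CL, η, hη, hL⟩ := hA.length_le
  obtain ⟨kO, CO, hO⟩ := hA.hasWordOutputs
  set M : ℝ := max CL 0 with hM
  have hM0 : 0 ≤ M := le_max_right _ _
  have hCLM : CL ≤ M := le_max_left _ _
  refine ⟨min ε η, lt_min hε hη, queryInput, max kO 1, 2 * M + 2, queryInput_isDeterministic,
    fun O hOans x => ?_⟩
  have hk : 1 ≤ max kO 1 := le_max_right _ _
  have hw : inputWidth (A.encode x) ≤ max kO 1 * A.width x := inputWidth_le_mul hk _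
  have hpow : 0 ≤ a (A.size x) ^ (1 - min ε η) := Real.rpow_nonneg (hA.nonneg _) _
  have hB2 : (2 : ℝ) ≤ (2 * M + 2) * a (A.size x) ^ (1 - min ε η) + (2 * M + 2) := by
    nlinarith
  have hB2' : 2 ≤ ⌊(2 * M + 2) * a (A.size x) ^ (1 - min ε η) + (2 * M + 2)⌋₊ :=
    Nat.le_floor (by exact_mod_cast hB2)
  obtain ⟨c, hc, hout, hq⟩ := queryInput_haltsWithin hw O zeroCoins hB2'
  have hgood : O (A.encode x) ∈ A.Good x := hOans x
  have hexact : (O (A.encode x)).map (· % 2 ^ (max kO 1 * A.width x)) = O (A.encode x) :=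
    map_mod_two_pow_eq_self fun v hv => lt_of_lt_of_le ((hO x _ hgood).2 v hv)
      (Nat.pow_le_pow_right Nat.two_pos (Nat.mul_le_mul_right _ (le_max_left _ _)))
  refine ⟨c, [x], hc, ?_, ?_, ?_, ?_⟩
  · rw [hout, hexact]; exact hgood
  · rw [hq]; rfl
  · have h1 : a (A.size x) ^ (1 - ε) ≤ a (A.size x) ^ (1 - min ε η) + 1 :=
      rpow_le_rpow_add_one_of_zero_or_one_le (ha _) (by linarith [min_le_left ε η])
    simp only [List.map_cons, List.map_nil, List.sum_cons, List.sum_nil, add_zero]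
    nlinarith
  · have h1 : a (A.size x) ^ (1 - η) ≤ a (A.size x) ^ (1 - min ε η) + 1 :=
      rpow_le_rpow_add_one_of_zero_or_one_le (ha _) (by linarith [min_le_right ε η])
    have h2 : 0 ≤ a (A.size x) ^ (1 - η) := Real.rpow_nonneg (hA.nonneg _) _
    have h3 : ((A.encode x).length : ℝ) ≤ CL * a (A.size x) ^ (1 - η) + CL := hL x
    simp only [List.map_cons, List.map_nil, List.sum_cons, List.sum_nil, add_zero]
    nlinarith

/-- Reflexivity of fine-grained reducibility for polynomial budgets `n ^ α`, `α ≥ 0` (which are `0`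
at `n = 0` and at least `1` for `n ≥ 1`). VVW ICM 2018, §2. [cite: VassilevskaWilliamsICM2018, §2] -/
theorem FGReducible.refl_rpow {A : FGProblem} {α : ℝ}
    (hA : A.IsStandard fun n => (n : ℝ) ^ α) (hα : 0 ≤ α) :
    FGReducible A (fun n => (n : ℝ) ^ α) A (fun n => (n : ℝ) ^ α) :=
  FGReducible.refl_of_budget hA fun n => by
    rcases Nat.eq_zero_or_pos n with rfl | hn
    · rcases eq_or_ne α 0 with rfl | hα0
      · right; simp
      · left; simp [Real.zero_rpow hα0]
    · right; exact Real.one_le_rpow (by exact_mod_cast hn) hα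

/-- Fine-grained equivalence is reflexive for well-formed problems and budgets `n ^ α`, `α ≥ 0`. [folklore] -/
theorem FGEquivalent.refl_rpow {A : FGProblem} {α : ℝ}
    (hA : A.IsStandard fun n => (n : ℝ) ^ α) (hα : 0 ≤ α) :
    FGEquivalent A (fun n => (n : ℝ) ^ α) A (fun n => (n : ℝ) ^ α) :=
  ⟨FGReducible.refl_rpow hA hα, FGReducible.refl_rpow hA hα⟩

/-- Subcubic equivalence is reflexive for well-formed problems. [folklore] -/
theorem SubcubicEquivalent.refl {A : FGProblem}
    (hA : A.IsStandard fun n => (n : ℝ) ^ (3 : ℝ)) : SubcubicEquivalent A A :=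
  FGEquivalent.refl_rpow hA (by norm_num)

/-- Subquadratic equivalence is reflexive for well-formed problems. [folklore] -/
theorem SubquadraticEquivalent.refl {A : FGProblem}
    (hA : A.IsStandard fun n => (n : ℝ) ^ (2 : ℝ)) : SubquadraticEquivalent A A :=
  FGEquivalent.refl_rpow hA (by norm_num)

/-! ## The transfer theorem (VVW ICM 2018, remark after Def. 2.1): elementary estimates -/

section estimates

/-- For a natural base, real powers are monotone in the exponent up to `+ 1`. [folklore] -/
theorem rpow_natCast_le_rpow_add_one (n : ℕ) {e₁ e₂ : ℝ} (he : e₁ ≤ e₂) :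
    (n : ℝ) ^ e₁ ≤ (n : ℝ) ^ e₂ + 1 :=
  rpow_le_rpow_add_one_of_zero_or_one_le
    (by rcases Nat.eq_zero_or_pos n with rfl | h
        · exact Or.inl (by simp)
        · exact Or.inr (by exact_mod_cast h)) he

/-- For a natural base, `n ^ e₁ * n ^ e₂ ≤ n ^ (e₁ + e₂) + 1` (equality unless `n = 0`).
[folklore] -/
theorem rpow_natCast_mul_rpow_le (n : ℕ) (e₁ e₂ : ℝ) :
    (n : ℝ) ^ e₁ * (n : ℝ) ^ e₂ ≤ (n : ℝ) ^ (e₁ + e₂) + 1 := by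
  rcases Nat.eq_zero_or_pos n with rfl | h
  · have h0 : ∀ e : ℝ, ((0 : ℕ) : ℝ) ^ e ≤ 1 := fun e => by
      rcases eq_or_ne e 0 with rfl | he
      · simp
      · rw [Nat.cast_zero, Real.zero_rpow he]; exact zero_le_one
    have := mul_le_mul (h0 e₁) (h0 e₂) (Real.rpow_nonneg (Nat.cast_nonneg _) _) zero_le_one
    have h2 : (0 : ℝ) ≤ ((0 : ℕ) : ℝ) ^ (e₁ + e₂) := Real.rpow_nonneg (Nat.cast_nonneg _) _
    linarith
  · rw [Real.rpow_add (by exact_mod_cast h)]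
    linarith

/-- A real power of `n < 2 ^ (K w)` is at most `2 ^ (⌈e⌉₊ K w) + 1`. [folklore] -/
theorem rpow_natCast_le_two_pow {n m : ℕ} (h : n < 2 ^ m) (e : ℝ) :
    (n : ℝ) ^ e ≤ ((2 ^ (⌈e⌉₊ * m) : ℕ) : ℝ) + 1 := by
  rcases Nat.eq_zero_or_pos n with rfl | hn
  · rcases eq_or_ne e 0 with rfl | he
    · simp
    · rw [Nat.cast_zero, Real.zero_rpow he]; positivity
  · have h1 : (1 : ℝ) ≤ n := by exact_mod_cast hn
    calc (n : ℝ) ^ e ≤ (n : ℝ) ^ ((⌈e⌉₊ : ℕ) : ℝ) :=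
          Real.rpow_le_rpow_of_exponent_le h1 (Nat.le_ceil e)
      _ = ((n ^ ⌈e⌉₊ : ℕ) : ℝ) := by rw [Real.rpow_natCast, Nat.cast_pow]
      _ ≤ ((2 ^ (⌈e⌉₊ * m) : ℕ) : ℝ) := by
          rw [Nat.mul_comm, Nat.pow_mul]
          exact_mod_cast Nat.pow_le_pow_left h.le _
      _ ≤ _ := by linarith

/-- **The bit size is sub-polynomial**: for every `η > 0` there is `D` with
`size m ≤ D · m ^ η + D` for all `m` (Bernoulli's inequality on `(2 ^ η) ^ (size m - 1) ≤ m ^ η`).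
[folklore] -/
theorem exists_size_le_rpow {η : ℝ} (hη : 0 < η) :
    ∃ D : ℝ, 0 ≤ D ∧ ∀ m : ℕ, (Nat.size m : ℝ) ≤ D * (m : ℝ) ^ η + D := by
  set r : ℝ := (2 : ℝ) ^ η with hr
  have hr1 : 1 < r := Real.one_lt_rpow (by norm_num) hη
  refine ⟨max (1 / (r - 1)) 1, le_trans zero_le_one (le_max_right _ _), fun m => ?_⟩
  rcases Nat.eq_zero_or_pos m with rfl | hm
  · simp only [Nat.size_zero, Nat.cast_zero]
    have : (0 : ℝ) ≤ max (1 / (r - 1)) 1 * (0 : ℝ) ^ η :=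
      mul_nonneg (le_trans zero_le_one (le_max_right _ _)) (Real.rpow_nonneg le_rfl _)
    linarith [le_max_right (1 / (r - 1)) 1]
  · -- `j := size m - 1`, `2 ^ j ≤ m`
    set j := Nat.size m - 1 with hj
    have hsz : Nat.size m = j + 1 := by
      have : 0 < Nat.size m := Nat.size_pos.2 hm
      omega
    have h2j : 2 ^ j ≤ m := Nat.lt_size.1 (by omega)
    -- `r ^ j ≤ m ^ η`
    have hrj : r ^ j ≤ (m : ℝ) ^ η := by
      rw [hr, ← Real.rpow_mul_natCast (by norm_num), mul_comm, Real.rpow_natCast_mul (by norm_num)]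
      exact Real.rpow_le_rpow (by positivity) (by exact_mod_cast h2j) hη.le
    -- Bernoulli
    have hB : 1 + (j : ℝ) * (r - 1) ≤ r ^ j := by
      have := one_add_mul_le_pow (a := r - 1) (by linarith) j
      simpa using this
    have hjle : (j : ℝ) ≤ (m : ℝ) ^ η / (r - 1) := by
      rw [le_div_iff₀ (by linarith)]; nlinarith
    have hD : 1 / (r - 1) ≤ max (1 / (r - 1)) 1 := le_max_left _ _
    have hmη : (0 : ℝ) ≤ (m : ℝ) ^ η := Real.rpow_nonneg (Nat.cast_nonneg _) _
    rw [hsz, Nat.cast_add, Nat.cast_one]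
    calc (j : ℝ) + 1 ≤ (1 / (r - 1)) * (m : ℝ) ^ η + 1 := by rw [one_div_mul_eq_div]; linarith
      _ ≤ max (1 / (r - 1)) 1 * (m : ℝ) ^ η + max (1 / (r - 1)) 1 :=
          add_le_add (mul_le_mul_of_nonneg_right hD hmη) (le_max_right _ _)

/-- `(C a + C) ^ η ≤ (2C) ^ η a ^ η + (2C) ^ η` for `η, C, a ≥ 0`. [folklore] -/
theorem rpow_affine_le {C a η : ℝ} (hC : 0 ≤ C) (ha : 0 ≤ a) (hη : 0 ≤ η) :
    (C * a + C) ^ η ≤ (2 * C) ^ η * a ^ η + (2 * C) ^ η := by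
  have h2C : 0 ≤ 2 * C := by linarith
  have hp : 0 ≤ (2 * C) ^ η * a ^ η := mul_nonneg (Real.rpow_nonneg h2C _) (Real.rpow_nonneg ha _)
  rcases le_or_gt 1 a with h1 | h1
  · calc (C * a + C) ^ η ≤ (2 * C * a) ^ η :=
          Real.rpow_le_rpow (by positivity) (by nlinarith) hη
      _ = (2 * C) ^ η * a ^ η := Real.mul_rpow h2C ha
      _ ≤ _ := le_add_of_nonneg_right (Real.rpow_nonneg h2C _)
  · calc (C * a + C) ^ η ≤ (2 * C) ^ η := Real.rpow_le_rpow (by positivity) (by nlinarith) hη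
      _ ≤ _ := le_add_of_nonneg_left hp

end estimates

/-! ## The oracle answered by an algorithm -/

/-- **The oracle of an algorithm.** If the deterministic oracle-free `M_B` solves `B` within
`T y` steps on every instance `y` (word size `k_B · width y`), then the function `O` sending a
word list `q` to the output of `M_B` on `q` (and `[]` if `M_B` does not halt on `q`) answers `B`,
and `M_B` computes `O (B.encode y)` within `s (B.encode y) ≤ T y` steps, where `s q` is the
halting time of `M_B` on `q`. [folklore] -/
theorem exists_oracle_of_algorithm {B : FGProblem} {MB : Program} {kB : ℕ} {T : B.Inst → ℕ}
    (hMB : ∀ y, ∃ out ∈ B.Good y,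
      OutputsWithin MB (kB * B.width y) noOracle zeroCoins (B.encode y) out (T y)) :
    ∃ (O : List ℕ → List ℕ) (s : List ℕ → ℕ), B.OracleAnswers O ∧
      ∀ y, s (B.encode y) ≤ T y ∧
        ∃ cB, HaltsWithin MB (kB * inputWidth (B.encode y)) noOracle zeroCoins (B.encode y)
          (s (B.encode y)) cB ∧ readOut cB.mem = O (B.encode y) := by
  classical
  let Hal : List ℕ → Prop := fun q => ∃ t c, HaltsWithin MB (kB * inputWidth q) noOracle zeroCoins q t c
  let O : List ℕ → List ℕ := fun q => if h : Hal q then readOut h.choose_spec.choose.mem else []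
  let s : List ℕ → ℕ := fun q => if h : Hal q then Nat.find h else 0
  have key : ∀ y, s (B.encode y) ≤ T y ∧ ∃ cB, HaltsWithin MB (kB * inputWidth (B.encode y)) noOracle
      zeroCoins (B.encode y) (s (B.encode y)) cB ∧ readOut cB.mem = O (B.encode y) ∧
      O (B.encode y) ∈ B.Good y := by
    intro y
    obtain ⟨out, hgood, c, hev, hst, hout⟩ := hMB y
    have hc : HaltsWithin MB (kB * inputWidth (B.encode y)) noOracle zeroCoins (B.encode y) (T y) c :=
      ⟨hev, hst⟩
    have hH : Hal (B.encode y) := ⟨T y, c, hc⟩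
    have hs : s (B.encode y) = Nat.find hH := by simp only [s, dif_pos hH]
    have hO : O (B.encode y) = readOut hH.choose_spec.choose.mem := by simp only [O, dif_pos hH]
    obtain ⟨cB, hcB⟩ := Nat.find_spec hH
    have h1 : cB = c := haltsWithin_unique_holds hcB hc
    have h2 : hH.choose_spec.choose = c := haltsWithin_unique_holds hH.choose_spec.choose_spec hc
    refine ⟨by rw [hs]; exact Nat.find_min' hH ⟨c, hc⟩, cB, by rw [hs]; exact hcB, ?_, ?_⟩
    · rw [hO, h2, h1]
    · rw [hO, h2, hout]; exact hgood
  exact ⟨O, s, fun y => (key y).2.choose_spec.2.2, fun y => ⟨(key y).1, (key y).2.choose,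
    (key y).2.choose_spec.1, (key y).2.choose_spec.2.1⟩⟩

/-! ## The word-size constant of the simulating machine -/

section numerics

/-- **The numeric side conditions of the simulation**, discharged for the word-size constant
`k' = k_B c₁ + m_B + c₁ + G + 11` and the value bound `V = 2 ^ (c₁ w) - 1`,
`c₁ = G + C_o + k + m + 2`, where `w ≥ 1` is the input width, `t ≤ 2 ^ (G w)` the time of the
reduction, `L < 2 ^ w` the input length, `m, m_B` the largest constants of `M, M_B`, `k, k_B`
their word-size constants and `C_o` the output constant of `B`. [folklore] -/
theorem sim_numerics {w G Co k m kB mB t L c₁ k' : ℕ} (hw : 1 ≤ w) (ht : t ≤ 2 ^ (G * w))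
    (hL : L < 2 ^ w) (hc₁ : c₁ = G + Co + k + m + 2) (hk' : k' = kB * c₁ + mB + c₁ + G + 11) :
    w ≤ k' * w ∧ k * w < k' * w ∧ L + 83 ≤ Inline.Qv (k' * w) ∧
      m ≤ 2 ^ (c₁ * w) - 1 ∧ 1 ≤ 2 ^ (c₁ * w) - 1 ∧ 2 ^ (k * w) - 1 ≤ 2 ^ (c₁ * w) - 1 ∧
      2 * (2 ^ (c₁ * w) - 1) + 121 ≤ Inline.Qv (k' * w) - 40 ∧
      kB * Nat.size (2 ^ (c₁ * w) - 1) < k' * w ∧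
      2 ^ (kB * Nat.size (2 ^ (c₁ * w) - 1)) ≤ 2 ^ (kB * c₁ * w) + mB ∧
      2 ^ (kB * c₁ * w) + mB < Inline.Qv (k' * w) ∧
      t + 2 ≤ 2 ^ (k' * w) ∧ Co * t + Co ≤ 2 ^ (c₁ * w) - 1 := by
  -- linear lower bounds for the products
  have hmono : ∀ {a b : ℕ}, a ≤ b → 2 ^ a ≤ 2 ^ b := fun h => Nat.pow_le_pow_right (by norm_num) h
  have hc₁w : c₁ * w = G * w + Co * w + k * w + m * w + 2 * w := by rw [hc₁]; ring
  have hk'w : k' * w = kB * c₁ * w + mB * w + c₁ * w + G * w + 11 * w := by rw [hk']; ring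
  have hCow : Co ≤ Co * w := Nat.le_mul_of_pos_right _ hw
  have hkw : k ≤ k * w := Nat.le_mul_of_pos_right _ hw
  have hmw : m ≤ m * w := Nat.le_mul_of_pos_right _ hw
  have hmBw : mB ≤ mB * w := Nat.le_mul_of_pos_right _ hw
  -- powers
  have hP1 : 1 ≤ 2 ^ (c₁ * w) := Nat.one_le_two_pow
  have hP2 : 2 ^ 1 ≤ 2 ^ (c₁ * w) := hmono (by omega)
  have hQ : Inline.Qv (k' * w) = 2 ^ (k' * w - 2) := rfl
  have hsize : Nat.size (2 ^ (c₁ * w) - 1) ≤ c₁ * w := Nat.size_le.2 (by omega)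
  have hkBs : kB * Nat.size (2 ^ (c₁ * w) - 1) ≤ kB * c₁ * w := by
    rw [Nat.mul_assoc]; exact Nat.mul_le_mul_left _ hsize
  refine ⟨by omega, by omega, ?_, ?_, by omega, ?_, ?_, by omega, ?_, ?_, ?_, ?_⟩
  · -- `L + 83 ≤ Q`
    rw [hQ]
    have h1 : 2 ^ w + 83 ≤ 2 ^ (w + 7) := by
      rw [Nat.pow_add]; have : 1 ≤ 2 ^ w := Nat.one_le_two_pow; omega
    have h2 : 2 ^ (w + 7) ≤ 2 ^ (k' * w - 2) := hmono (by omega)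
    omega
  · -- `m ≤ V`
    have h1 : m + 1 ≤ 2 ^ m := m.lt_two_pow_self
    have h2 : 2 ^ m ≤ 2 ^ (c₁ * w) := hmono (by omega)
    omega
  · -- `2 ^ (k w) - 1 ≤ V`
    have := hmono (show k * w ≤ c₁ * w by omega); omega
  · -- `2 V + 121 ≤ Q - 40`
    rw [hQ]
    have h1 : 2 * (2 ^ (c₁ * w) - 1) + 161 ≤ 2 ^ (c₁ * w + 9) := by
      rw [Nat.pow_add]; omega
    have h2 : 2 ^ (c₁ * w + 9) ≤ 2 ^ (k' * w - 2) := hmono (by omega)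
    omega
  · -- `2 ^ (kB size V) ≤ VB`
    have := hmono hkBs; omega
  · -- `VB < Q`
    rw [hQ]
    have h1 : mB + 1 ≤ 2 ^ mB := mB.lt_two_pow_self
    have h2 : 2 ^ (kB * c₁ * w) + 2 ^ mB ≤ 2 ^ (kB * c₁ * w + mB + 1) := by
      have ha : 2 ^ (kB * c₁ * w) ≤ 2 ^ (kB * c₁ * w + mB) := hmono (by omega)
      have hb : 2 ^ mB ≤ 2 ^ (kB * c₁ * w + mB) := hmono (by omega)
      rw [Nat.pow_succ]; omega
    have h3 : 2 ^ (kB * c₁ * w + mB + 1) ≤ 2 ^ (k' * w - 2) := hmono (by omega)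
    omega
  · -- `t + 2 ≤ 2 ^ W`
    have h1 : 2 ^ (G * w) + 2 ≤ 2 ^ (G * w + 2) := by
      rw [Nat.pow_add]; have : 1 ≤ 2 ^ (G * w) := Nat.one_le_two_pow; omega
    have h2 : 2 ^ (G * w + 2) ≤ 2 ^ (k' * w) := hmono (by omega)
    omega
  · -- `Co t + Co ≤ V`
    have h1 : Co * t + Co ≤ Co * (2 ^ (G * w) + 1) := by
      rw [Nat.mul_add, Nat.mul_one]; exact Nat.add_le_add_right (Nat.mul_le_mul_left _ ht) _
    have h2 : Co * (2 ^ (G * w) + 1) ≤ 2 ^ Co * 2 ^ (G * w + 1) :=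
      Nat.mul_le_mul ((show Co + 1 ≤ 2 ^ Co from Co.lt_two_pow_self).trans' (Nat.le_succ _))
        (by rw [Nat.pow_succ]; have : 1 ≤ 2 ^ (G * w) := Nat.one_le_two_pow; omega)
    have h3 : 2 ^ Co * 2 ^ (G * w + 1) = 2 ^ (Co + (G * w + 1)) := (Nat.pow_add _ _ _).symm
    have h4 : 2 ^ (Co + (G * w + 1)) ≤ 2 ^ (c₁ * w - 1) := hmono (by omega)
    have h5 : 2 ^ (c₁ * w - 1) < 2 ^ (c₁ * w) := Nat.pow_lt_pow_right (by norm_num) (by omega)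
    omega

end numerics

/-! ## The simulating machine on one instance -/

/-- A list sum bounded termwise by a linear form is bounded by the linear form of the sums. [folklore] -/
theorem sum_map_le_linear {ι : Type} (l : List ι) (f g h : ι → ℝ) (a b c : ℝ)
    (hf : ∀ y ∈ l, f y ≤ a * g y + b * h y + c) :
    (l.map f).sum ≤ a * (l.map g).sum + b * (l.map h).sum + c * l.length := by
  induction l with
  | nil => simp
  | cons y l ih =>
    simp only [List.map_cons, List.sum_cons, List.length_cons, Nat.cast_succ]
    have h1 := hf y (by simp)
    have h2 := ih fun z hz => hf z (by simp [hz])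
    nlinarith

/-- **The simulating machine on one instance.** Given the reduction `M` (constant `C ≥ 0`,
exponent `δ`, ledger exponent `ε`) run with the oracle `O` computed by `M_B` in time `s`
(`s (B.encode y) ≤ C_B (n_y ^ β) ^ (1 - ε) + 2 C_B`), the output-length constants `C_o` of `B`
and `C_oA` of `A`, and `A.size x < 2 ^ (K · width x)`, the simulating machine with word-size
constant `k'` outputs the reduction's (accepted) output on `x` within any `T` at least
`(20 + 6 C_oA) L + 20 · size (k' w) · (1 + B₀) + (135 + 32 C_o + 114 C_B) B₀ + 615 + 6 C_oA`,
where `L = |A.encode x|`, `w = A.width x`, `B₀ = C (n ^ α) ^ (1 - δ) + C`. [folklore] -/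
theorem sim_instance {A B : FGProblem} {α β δ ε C CB : ℝ} {M MB : Program} {k kB K Co CoA : ℕ}
    {O : List ℕ → List ℕ} {s : List ℕ → ℕ}
    (hdet : M.IsDeterministic) (hBdet : MB.IsDeterministic) (hBof : MB.IsOracleFree)
    (hC : 0 ≤ C) (hCB : 0 ≤ CB) (hK : ∀ x, A.size x < 2 ^ (K * A.width x))
    (hs : ∀ y, ∃ cB, HaltsWithin MB (kB * inputWidth (B.encode y)) noOracle zeroCoins (B.encode y)
      (s (B.encode y)) cB ∧ readOut cB.mem = O (B.encode y))
    (hsT : ∀ y, (s (B.encode y) : ℝ) ≤ CB * ((B.size y : ℝ) ^ β) ^ (1 - ε) + 2 * CB)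
    (hOlen : ∀ y, (O (B.encode y)).length ≤ Co * (B.encode y).length + Co)
    (hAout : ∀ x, ∀ out ∈ A.Good x, out.length ≤ CoA * (A.encode x).length + CoA)
    (hred : ∀ x, ∃ (c : Cfg) (bs : List B.Inst),
      HaltsWithin M (k * A.width x) O zeroCoins (A.encode x)
          ⌊C * ((A.size x : ℝ) ^ α) ^ (1 - δ) + C⌋₊ c ∧
        readOut c.mem ∈ A.Good x ∧ c.queries = bs.map B.encode ∧
        (bs.map fun y => ((B.size y : ℝ) ^ β) ^ (1 - ε)).sum ≤
            C * ((A.size x : ℝ) ^ α) ^ (1 - δ) + C ∧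
        ((bs.map fun y => (B.encode y).length).sum : ℝ) ≤ C * ((A.size x : ℝ) ^ α) ^ (1 - δ) + C)
    {G c₁ k' : ℕ} (hG : G = ⌈C⌉₊ + ⌈α * (1 - δ)⌉₊ * K + 2)
    (hc₁ : c₁ = G + Co + k + Program.maxConst M + 2)
    (hk' : k' = kB * c₁ + Program.maxConst MB + c₁ + G + 11) (x : A.Inst) :
    ∃ out ∈ A.Good x, ∀ T : ℕ,
      (20 + 6 * (CoA : ℝ)) * (A.encode x).length +
          20 * (Nat.size (k' * A.width x) : ℝ) * (1 + (C * ((A.size x : ℝ) ^ α) ^ (1 - δ) + C)) +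
          (135 + 32 * (Co : ℝ) + 114 * CB) * (C * ((A.size x : ℝ) ^ α) ^ (1 - δ) + C) +
          (615 + 6 * (CoA : ℝ)) ≤ (T : ℝ) →
        OutputsWithin (Inline.SIM M k MB kB) (k' * A.width x) noOracle zeroCoins (A.encode x) out T := by
  obtain ⟨c, bs, hHalt, hgood, hqs, hledger, hlen⟩ := hred x
  refine ⟨readOut c.mem, hgood, fun T hT => ?_⟩
  set w := A.width x with hwdef
  have hw1 : 1 ≤ w := A.width_pos x
  have hpow0 : (0 : ℝ) ≤ ((A.size x : ℝ) ^ α) ^ (1 - δ) :=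
    Real.rpow_nonneg (Real.rpow_nonneg (Nat.cast_nonneg _) _) _
  have hB₀0 : 0 ≤ C * ((A.size x : ℝ) ^ α) ^ (1 - δ) + C := by positivity
  have htB : ((⌊C * ((A.size x : ℝ) ^ α) ^ (1 - δ) + C⌋₊ : ℕ) : ℝ) ≤
      C * ((A.size x : ℝ) ^ α) ^ (1 - δ) + C := Nat.floor_le hB₀0
  -- `t ≤ 2 ^ (G w)`
  have htG : ⌊C * ((A.size x : ℝ) ^ α) ^ (1 - δ) + C⌋₊ ≤ 2 ^ (G * w) := by
    have h1 : ((A.size x : ℝ) ^ α) ^ (1 - δ) ≤ ((2 ^ (⌈α * (1 - δ)⌉₊ * (K * w)) : ℕ) : ℝ) + 1 := by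
      rw [← Real.rpow_mul (Nat.cast_nonneg _)]
      exact rpow_natCast_le_two_pow (hK x) _
    generalize hP : 2 ^ (⌈α * (1 - δ)⌉₊ * (K * w)) = P at h1
    have hP1 : 1 ≤ P := by rw [← hP]; exact Nat.one_le_two_pow
    have h2 : C * ((A.size x : ℝ) ^ α) ^ (1 - δ) + C ≤ ((⌈C⌉₊ * (P + 2) : ℕ) : ℝ) := by
      have hCc : C ≤ ⌈C⌉₊ := Nat.le_ceil C
      have hP0 : (0 : ℝ) ≤ (P : ℝ) := Nat.cast_nonneg _
      have e1 : C * ((A.size x : ℝ) ^ α) ^ (1 - δ) ≤ C * ((P : ℝ) + 1) :=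
        mul_le_mul_of_nonneg_left h1 hC
      have e2 : C * ((P : ℝ) + 2) ≤ (⌈C⌉₊ : ℝ) * ((P : ℝ) + 2) :=
        mul_le_mul_of_nonneg_right hCc (by linarith)
      push_cast
      linarith
    have h3 : ⌊C * ((A.size x : ℝ) ^ α) ^ (1 - δ) + C⌋₊ ≤ ⌈C⌉₊ * (P + 2) := by
      rw [← Nat.floor_natCast (R := ℝ) (⌈C⌉₊ * (P + 2))]; exact Nat.floor_le_floor h2
    have h4 : ⌈C⌉₊ * (P + 2) ≤ 2 ^ ⌈C⌉₊ * (4 * P) :=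
      Nat.mul_le_mul ((show ⌈C⌉₊ + 1 ≤ 2 ^ ⌈C⌉₊ from Nat.lt_two_pow_self).trans' (Nat.le_succ _))
        (by omega)
    have h5 : 2 ^ ⌈C⌉₊ * (4 * P) ≤ 2 ^ (G * w) := by
      rw [← hP, show 4 * 2 ^ (⌈α * (1 - δ)⌉₊ * (K * w)) = 2 ^ (⌈α * (1 - δ)⌉₊ * (K * w) + 2) by
        rw [Nat.pow_add]; ring, ← Nat.pow_add]
      refine Nat.pow_le_pow_right (by norm_num) ?_
      have hGw : G * w = ⌈C⌉₊ * w + ⌈α * (1 - δ)⌉₊ * (K * w) + 2 * w := by rw [hG]; ring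
      have : ⌈C⌉₊ ≤ ⌈C⌉₊ * w := Nat.le_mul_of_pos_right _ hw1
      omega
    omega
  -- make the budget and the time opaque
  generalize hB₀ : C * ((A.size x : ℝ) ^ α) ^ (1 - δ) + C = B₀ at hHalt hledger hlen hT hB₀0 htB htG
  generalize ht : ⌊B₀⌋₊ = t at hHalt htB htG
  -- numerics
  obtain ⟨n2, n3, n4, n5, n6, n7, n8, n9, n10, n11, n12, n13⟩ :=
    sim_numerics (Co := Co) (k := k) (m := Program.maxConst M) (kB := kB) (mB := Program.maxConst MB)
      hw1 htG (length_lt_two_pow_inputWidth (A.encode x)) hc₁ hk'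
  -- the queries
  have hmemq : ∀ q ∈ c.queries, ∃ y ∈ bs, B.encode y = q := fun q hq => by
    rw [hqs] at hq; simpa [List.mem_map] using hq
  have hency : ∀ y ∈ bs, (B.encode y).length ≤ t := fun y hy => by
    rw [← ht]
    refine Nat.le_floor (le_trans ?_ hlen)
    have := List.le_sum_of_mem (List.mem_map_of_mem (f := fun y => (B.encode y).length) hy)
    exact_mod_cast this
  have hO : ∀ q ∈ c.queries, (O q).length ≤ 2 ^ (c₁ * w) - 1 := fun q hq => by
    obtain ⟨y, hy, rfl⟩ := hmemq q hq
    have := hOlen y; have := hency y hy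
    have : Co * (B.encode y).length ≤ Co * t := Nat.mul_le_mul_left _ this
    omega
  have hMB : ∀ q ∈ c.queries, ∃ cB, HaltsWithin MB (kB * inputWidth q) noOracle zeroCoins q (s q) cB ∧
      readOut cB.mem = O q := fun q hq => by
    obtain ⟨y, -, rfl⟩ := hmemq q hq
    exact hs y
  have hbs : (bs.length : ℝ) ≤ B₀ := by
    obtain ⟨nM, hnM, hrunM, -⟩ := hHalt.exists_run
    have h1 := run_queries_length nM hrunM
    simp only [init_queries, List.length_nil, Nat.zero_add, hqs, List.length_map] at h1
    have : (bs.length : ℝ) ≤ t := by exact_mod_cast h1.trans hnM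
    linarith
  -- the simulation theorem
  refine Inline.outputsWithin_SIM hdet hBdet hBof n2 n3 n4 n5 n6 n7 n8 n9 n10
    (Nat.le_add_left _ _) n11 hHalt n12 hO hMB noOracle zeroCoins (Nat.cast_le.1 (le_trans ?_ hT))
  -- the cost, in `ℝ`
  have hsW0 : (0 : ℝ) ≤ (Nat.size (k' * w) : ℝ) := Nat.cast_nonneg _
  generalize hsW : (Nat.size (k' * w) : ℝ) = sW at hT hsW0
  have hℓ : ((readOut c.mem).length : ℝ) ≤ CoA * (A.encode x).length + CoA := by
    exact_mod_cast hAout x _ hgood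
  -- the charges
  have hch : (((c.queries.map (Inline.charge (k' * w) O s)).sum : ℕ) : ℝ) ≤
      (20 + 16 * Co) * B₀ + 38 * CB * B₀ + (20 * sW + 77 + 76 * CB + 16 * Co) * B₀ := by
    rw [Nat.cast_list_sum, List.map_map, hqs, List.map_map]
    have step := sum_map_le_linear bs (fun y => ((Inline.charge (k' * w) O s (B.encode y) : ℕ) : ℝ))
      (fun y => ((B.encode y).length : ℝ)) (fun y => ((B.size y : ℝ) ^ β) ^ (1 - ε))
      (20 + 16 * Co) (38 * CB) (20 * sW + 77 + 76 * CB + 16 * Co) fun y _ => by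
        have h1 := hsT y
        have h2 : ((O (B.encode y)).length : ℝ) ≤ Co * (B.encode y).length + Co := by
          exact_mod_cast hOlen y
        simp only [Inline.charge, Inline.qbCost]
        push_cast
        rw [hsW]
        linarith
    have hsum1 : (bs.map fun y => ((B.encode y).length : ℝ)).sum ≤ B₀ := by
      have : (((bs.map fun y => (B.encode y).length).sum : ℕ) : ℝ) =
          (bs.map fun y => ((B.encode y).length : ℝ)).sum := by rw [Nat.cast_list_sum, List.map_map]; rfl
      rw [← this]; exact hlen
    have hc1 : (0 : ℝ) ≤ 20 + 16 * Co := by positivity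
    have hc2 : (0 : ℝ) ≤ 38 * CB := by positivity
    have hc3 : (0 : ℝ) ≤ 20 * sW + 77 + 76 * CB + 16 * Co := by positivity
    have e1 : (20 + 16 * (Co : ℝ)) * (bs.map fun y => ((B.encode y).length : ℝ)).sum ≤
        (20 + 16 * Co) * B₀ :=
      mul_le_mul_of_nonneg_left hsum1 hc1
    have e2 : 38 * CB * (bs.map fun y => ((B.size y : ℝ) ^ β) ^ (1 - ε)).sum ≤ 38 * CB * B₀ :=
      mul_le_mul_of_nonneg_left hledger hc2
    have e3 : (20 * sW + 77 + 76 * CB + 16 * Co) * (bs.length : ℝ) ≤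
        (20 * sW + 77 + 76 * CB + 16 * Co) * B₀ :=
      mul_le_mul_of_nonneg_left hbs hc3
    exact le_trans step (by linarith)
  -- total
  have hcost : ((Inline.simCost (A.encode x).length (k' * w) t
      ((c.queries.map (Inline.charge (k' * w) O s)).sum) (readOut c.mem).length : ℕ) : ℝ) =
      20 * (A.encode x).length + 20 * sW + 275 + 38 * t +
        (((c.queries.map (Inline.charge (k' * w) O s)).sum : ℕ) : ℝ) +
        (6 * (readOut c.mem).length + 340) := by
    simp only [Inline.simCost, Inline.proCost, widthCost, Inline.epiCost, cstep]
    push_cast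
    rw [hsW]
    ring
  rw [hcost]
  have e4 : 0 ≤ sW * B₀ := mul_nonneg hsW0 hB₀0
  linarith

/-! ## Growth rates: the exponents of the simulation are truly sub-`α` -/

section growth

/-- Positivising the constant of an affine bound `v ≤ C a + C` (`a ≥ 0`). [folklore] -/
theorem affine_le_affine_max {v C a : ℝ} (h : v ≤ C * a + C) (ha : 0 ≤ a) :
    v ≤ max C 0 * a + max C 0 := by
  have h1 : C * a ≤ max C 0 * a := mul_le_mul_of_nonneg_right (le_max_left _ _) ha
  have h2 : C ≤ max C 0 := le_max_left _ _
  linarith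

/-- The natural floor of an affine bound is at most its positivised form. [folklore] -/
theorem natFloor_affine_le {C a : ℝ} (ha : 0 ≤ a) :
    ((⌊C * a + C⌋₊ : ℕ) : ℝ) ≤ max C 0 * a + max C 0 := by
  have hle : C * a + C ≤ max C 0 * a + max C 0 := affine_le_affine_max le_rfl ha
  have h0 : 0 ≤ max C 0 * a + max C 0 := by positivity
  rcases le_or_gt 0 (C * a + C) with h | h
  · exact (Nat.floor_le h).trans hle
  · rw [Nat.floor_of_nonpos h.le, Nat.cast_zero]; exact h0

/-- For `1 ≤ n ≤ N`, `n ^ e ≤ N ^ |e|`. [folklore] -/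
theorem rpow_le_rpow_abs_of_one_le {n N : ℝ} (h1 : 1 ≤ n) (hN : n ≤ N) (e : ℝ) :
    n ^ e ≤ N ^ |e| :=
  (Real.rpow_le_rpow_of_exponent_le h1 (le_abs_self e)).trans
    (Real.rpow_le_rpow (by linarith) hN (abs_nonneg e))

/-- **The exponents of the simulation are truly sub-`α`.** For a problem whose width is
`O(n ^ α)` and whose size fits in a word, and exponents `δ_L, δ > 0`, `0 < η ≤ min (δ/2) (1/2)`,
there are `ε' > 0` and `R` with `n ^ e ≤ n ^ (α - ε') + R` on all instance sizes `n`, for each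
of the four exponents `e ∈ {α(1-δ_L), α(1-δ), αη, αη + α(1-δ)}` occurring in the cost of the
simulating machine. (For `α > 0` take `ε' = α · min (δ_L, δ/2, 1/2)`, `R = 1`; for `α ≤ 0` the
width is bounded, hence — the size fitting in a word — so is the size, and every power of it is
bounded by a constant.) [folklore] -/
theorem exists_subExponent {A : FGProblem} {α Cw : ℝ} {K : ℕ}
    (hw : ∀ x, (A.width x : ℝ) ≤ Cw * (A.size x : ℝ) ^ α + Cw)
    (hK : ∀ x, A.size x < 2 ^ (K * A.width x)) {δL δ η : ℝ} (hδL : 0 < δL) (hδ : 0 < δ)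
    (hη : 0 < η) (hηδ : η ≤ δ / 2) (hη2 : η ≤ 1 / 2) :
    ∃ ε' : ℝ, 0 < ε' ∧ ∃ R : ℝ, 0 ≤ R ∧ ∀ x,
      ∀ e ∈ [α * (1 - δL), α * (1 - δ), α * η, α * η + α * (1 - δ)],
        (A.size x : ℝ) ^ e ≤ (A.size x : ℝ) ^ (α - ε') + R := by
  rcases lt_or_ge 0 α with hα | hα
  · refine ⟨α * min (min δL (δ / 2)) (1 / 2), by positivity, 1, zero_le_one, fun x e he => ?_⟩
    apply rpow_natCast_le_rpow_add_one
    have hm1 : min (min δL (δ / 2)) (1 / 2) ≤ δL := (min_le_left _ _).trans (min_le_left _ _)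
    have hm2 : min (min δL (δ / 2)) (1 / 2) ≤ δ / 2 := (min_le_left _ _).trans (min_le_right _ _)
    have hm3 : min (min δL (δ / 2)) (1 / 2) ≤ 1 / 2 := min_le_right _ _
    generalize min (min δL (δ / 2)) (1 / 2) = μ at hm1 hm2 hm3
    simp only [List.mem_cons, List.not_mem_nil, or_false] at he
    rcases he with rfl | rfl | rfl | rfl
    · nlinarith
    · nlinarith
    · nlinarith
    · nlinarith
  · -- the sizes of instances are bounded
    obtain ⟨N₀, hn⟩ : ∃ N₀ : ℕ, ∀ x, 1 ≤ A.size x → A.size x ≤ N₀ := by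
      refine ⟨2 ^ (K * ⌊2 * max Cw 0⌋₊), fun x hx => ?_⟩
      have h1 : (1 : ℝ) ≤ A.size x := by exact_mod_cast hx
      have hna : (A.size x : ℝ) ^ α ≤ 1 := Real.rpow_le_one_of_one_le_of_nonpos h1 hα
      have hw' := affine_le_affine_max (hw x) (Real.rpow_nonneg (Nat.cast_nonneg _) _)
      have hCw0 : 0 ≤ max Cw 0 := le_max_right _ _
      have hwle : (A.width x : ℝ) ≤ 2 * max Cw 0 := by nlinarith
      have hwW : A.width x ≤ ⌊2 * max Cw 0⌋₊ := Nat.le_floor hwle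
      have h2 := hK x
      have h3 : 2 ^ (K * A.width x) ≤ 2 ^ (K * ⌊2 * max Cw 0⌋₊) :=
        Nat.pow_le_pow_right (by norm_num) (Nat.mul_le_mul_left _ hwW)
      omega
    obtain ⟨E, heE⟩ : ∃ E : ℝ, ∀ e ∈ [α * (1 - δL), α * (1 - δ), α * η, α * η + α * (1 - δ)],
        |e| ≤ E := by
      refine ⟨|α * (1 - δL)| + |α * (1 - δ)| + |α * η| + |α * η + α * (1 - δ)|, fun e he => ?_⟩
      have a1 := abs_nonneg (α * (1 - δL))
      have a2 := abs_nonneg (α * (1 - δ))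
      have a3 := abs_nonneg (α * η)
      have a4 := abs_nonneg (α * η + α * (1 - δ))
      simp only [List.mem_cons, List.not_mem_nil, or_false] at he
      rcases he with rfl | rfl | rfl | rfl <;> linarith
    have hNE : (0 : ℝ) ≤ (N₀ : ℝ) ^ E := Real.rpow_nonneg (Nat.cast_nonneg _) _
    refine ⟨1, one_pos, (N₀ : ℝ) ^ E + 1, by positivity, fun x e he => ?_⟩
    have hP : (0 : ℝ) ≤ (A.size x : ℝ) ^ (α - 1) := Real.rpow_nonneg (Nat.cast_nonneg _) _
    rcases Nat.eq_zero_or_pos (A.size x) with h0 | hpos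
    · rw [h0, Nat.cast_zero]
      have : (0 : ℝ) ^ e ≤ 1 := by
        rcases eq_or_ne e 0 with rfl | he0
        · simp
        · rw [Real.zero_rpow he0]; exact zero_le_one
      have : (0 : ℝ) ≤ (0 : ℝ) ^ (α - 1) := Real.rpow_nonneg le_rfl _
      linarith
    · have h1 : (1 : ℝ) ≤ A.size x := by exact_mod_cast hpos
      have hN : (A.size x : ℝ) ≤ N₀ := by exact_mod_cast hn x hpos
      have hN1 : (1 : ℝ) ≤ N₀ := h1.trans hN
      calc (A.size x : ℝ) ^ e ≤ (N₀ : ℝ) ^ |e| := rpow_le_rpow_abs_of_one_le h1 hN e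
        _ ≤ (N₀ : ℝ) ^ E := Real.rpow_le_rpow_of_exponent_le hN1 (heE e he)
        _ ≤ _ := by linarith

/-- **The cost of the simulating machine is linear in a common majorant** `Y ≥ 1` of the powers
`X₁ = n^{α(1-δ_L)}` (input length), `X₂ = n^{α(1-δ)}` (budget), `X₃ = n^{αη}` (bit size of the
word size) and `X₃ X₂`: pure bookkeeping for `FGReducible.trulySubTime_of_sizeFitsWord_holds`.
[folklore] -/
theorem sim_cost_le_linear {CoA Co CB' C' CL' D u L sW X₁ X₂ X₃ Y : ℝ}
    (hCoA : 0 ≤ CoA) (hCo : 0 ≤ Co) (hCB' : 0 ≤ CB') (hC' : 0 ≤ C') (hCL' : 0 ≤ CL')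
    (hD : 0 ≤ D) (hu : 0 ≤ u) (hX₂ : 0 ≤ X₂) (hY : 1 ≤ Y) (h₁ : X₁ ≤ Y)
    (h₂ : X₂ ≤ Y) (h₃ : X₃ ≤ Y) (h₄ : X₃ * X₂ ≤ Y) (hL : L ≤ CL' * X₁ + CL')
    (hsW : sW ≤ D * u * X₃ + (D * u + D)) :
    (20 + 6 * CoA) * L + 20 * sW * (1 + (C' * X₂ + C')) +
          (135 + 32 * Co + 114 * CB') * (C' * X₂ + C') + (615 + 6 * CoA) + 1 ≤
      ((20 + 6 * CoA) * (2 * CL') +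
          20 * ((1 + C') * (2 * (D * u) + D) + C' * (D * u) + C' * (D * u + D)) +
          (135 + 32 * Co + 114 * CB') * (2 * C') + (615 + 6 * CoA) + 1) * Y := by
  have hL' : L ≤ 2 * CL' * Y := by nlinarith [mul_le_mul_of_nonneg_left h₁ hCL']
  have hB : C' * X₂ + C' ≤ 2 * C' * Y := by nlinarith [mul_le_mul_of_nonneg_left h₂ hC']
  have hDu : 0 ≤ D * u := mul_nonneg hD hu
  have hmid : sW * (1 + (C' * X₂ + C')) ≤
      ((1 + C') * (2 * (D * u) + D) + C' * (D * u) + C' * (D * u + D)) * Y := by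
    have h1 : sW * (1 + (C' * X₂ + C')) ≤ (D * u * X₃ + (D * u + D)) * (1 + (C' * X₂ + C')) :=
      mul_le_mul_of_nonneg_right hsW (by positivity)
    have hexp : (D * u * X₃ + (D * u + D)) * (1 + (C' * X₂ + C')) =
        (1 + C') * (D * u * X₃ + (D * u + D)) + C' * (D * u) * (X₃ * X₂) +
          C' * (D * u + D) * X₂ := by ring
    rw [hexp] at h1
    have p1 := mul_le_mul_of_nonneg_left h₃ hDu
    have p2 := mul_le_mul_of_nonneg_left h₄ (mul_nonneg hC' hDu)
    have p3 := mul_le_mul_of_nonneg_left h₂ (mul_nonneg hC' (add_nonneg hDu hD))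
    have p4 : (1 + C') * (D * u * X₃ + (D * u + D)) ≤ (1 + C') * ((2 * (D * u) + D) * Y) := by
      refine mul_le_mul_of_nonneg_left ?_ (by positivity)
      nlinarith
    nlinarith
  have q1 := mul_le_mul_of_nonneg_left hL' (show (0 : ℝ) ≤ 20 + 6 * CoA by positivity)
  have q2 := mul_le_mul_of_nonneg_left hmid (show (0 : ℝ) ≤ 20 by norm_num)
  have q3 := mul_le_mul_of_nonneg_left hB (show (0 : ℝ) ≤ 135 + 32 * Co + 114 * CB' by positivity)
  have q4 : (615 + 6 * CoA) + 1 ≤ ((615 + 6 * CoA) + 1) * Y := by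
    have : (0 : ℝ) ≤ (615 + 6 * CoA) + 1 := by positivity
    nlinarith
  nlinarith

end growth

/-! ## The transfer theorem -/

/-- **VVW ICM 2018, the remark after Def. 2.1 (corrected transcription), proved in the model**:
if `(A, n^α) ≤_FG (B, n^β)`, `B` is truly sub-`n^β`, both problems are well formed and the size
measure of `A` fits in `O(1)` words, then `A` is truly sub-`n^α`. The algorithm is the
simulating machine `WordRAM.Inline.SIM M k M_B k_B` of the reduction `M` with every oracle call
answered by an inline run of `B`'s algorithm `M_B`; its running time is bounded by
`sim_instance`, and the exponent bookkeeping is `exists_subExponent`.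
[cite: VassilevskaWilliamsICM2018, Def. 2.1 and the remark following it] -/
theorem FGReducible.trulySubTime_of_sizeFitsWord_holds :
    FGReducible.trulySubTime_of_sizeFitsWord := by
  intro A B α β h hB hA hB' hsz
  classical
  -- `B`'s algorithm and the oracle it computes
  obtain ⟨εB, hεB, CB, MB, kB, hBdet, hBof, hMBrun⟩ := hB
  obtain ⟨O, s, hOans, hOs⟩ := exists_oracle_of_algorithm hMBrun
  -- the ledger exponent at which the reduction is invoked
  obtain ⟨ε, hε, hβε⟩ : ∃ ε : ℝ, 0 < ε ∧ β - εB ≤ β * (1 - ε) := by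
    rcases lt_or_ge 0 β with hβ | hβ
    · exact ⟨εB / β, div_pos hεB hβ, by rw [mul_sub, mul_one, mul_div_cancel₀ _ hβ.ne']⟩
    · exact ⟨1, one_pos, by nlinarith⟩
  -- the reduction
  obtain ⟨δ, hδ, M, k, C, hdet, hM⟩ := h ε hε
  -- the constants of well-formedness
  obtain ⟨CL, δL, hδL, hCL⟩ := hA.length_le
  obtain ⟨Cw, hCw⟩ := hA.width_le
  obtain ⟨_kA, CoA, hCoA⟩ := hA.hasWordOutputs
  obtain ⟨_kO, Co, hCo⟩ := hB'.hasWordOutputs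
  obtain ⟨K, hK⟩ := hsz
  beta_reduce at hM hCL hCw hOs
  -- positivised constants
  have hC' : 0 ≤ max C 0 := le_max_right _ _
  have hCB' : 0 ≤ max CB 0 := le_max_right _ _
  have hCL' : 0 ≤ max CL 0 := le_max_right _ _
  have hCw' : 0 ≤ max Cw 0 := le_max_right _ _
  -- the hypotheses of `sim_instance`
  have hs : ∀ y, ∃ cB, HaltsWithin MB (kB * inputWidth (B.encode y)) noOracle zeroCoins (B.encode y)
      (s (B.encode y)) cB ∧ readOut cB.mem = O (B.encode y) := fun y => (hOs y).2
  have hsT : ∀ y, (s (B.encode y) : ℝ) ≤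
      max CB 0 * ((B.size y : ℝ) ^ β) ^ (1 - ε) + 2 * max CB 0 := by
    intro y
    have h1 : (s (B.encode y) : ℝ) ≤ ((⌊CB * (B.size y : ℝ) ^ (β - εB) + CB⌋₊ : ℕ) : ℝ) := by
      exact_mod_cast (hOs y).1
    have h2 := natFloor_affine_le (C := CB) (Real.rpow_nonneg (Nat.cast_nonneg (B.size y)) (β - εB))
    have h3 : (B.size y : ℝ) ^ (β - εB) ≤ ((B.size y : ℝ) ^ β) ^ (1 - ε) + 1 := by
      rw [← Real.rpow_mul (Nat.cast_nonneg _)]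
      exact rpow_natCast_le_rpow_add_one _ hβε
    have h4 := mul_le_mul_of_nonneg_left h3 hCB'
    linarith
  have hOlen : ∀ y, (O (B.encode y)).length ≤ Co * (B.encode y).length + Co :=
    fun y => (hCo y _ (hOans y)).1
  have hAout : ∀ x, ∀ out ∈ A.Good x, out.length ≤ CoA * (A.encode x).length + CoA :=
    fun x out hout => (hCoA x out hout).1
  have hred : ∀ x, ∃ (c : Cfg) (bs : List B.Inst),
      HaltsWithin M (k * A.width x) O zeroCoins (A.encode x)
          ⌊max C 0 * ((A.size x : ℝ) ^ α) ^ (1 - δ) + max C 0⌋₊ c ∧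
        readOut c.mem ∈ A.Good x ∧ c.queries = bs.map B.encode ∧
        (bs.map fun y => ((B.size y : ℝ) ^ β) ^ (1 - ε)).sum ≤
            max C 0 * ((A.size x : ℝ) ^ α) ^ (1 - δ) + max C 0 ∧
        ((bs.map fun y => (B.encode y).length).sum : ℝ) ≤
            max C 0 * ((A.size x : ℝ) ^ α) ^ (1 - δ) + max C 0 := by
    intro x
    obtain ⟨c, bs, h1, h2, h3, h4, h5⟩ := hM O hOans x
    have hle : C * ((A.size x : ℝ) ^ α) ^ (1 - δ) + C ≤
        max C 0 * ((A.size x : ℝ) ^ α) ^ (1 - δ) + max C 0 :=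
      affine_le_affine_max le_rfl (Real.rpow_nonneg (Real.rpow_nonneg (Nat.cast_nonneg _) _) _)
    exact ⟨c, bs, h1.mono (Nat.floor_mono hle), h2, h3, h4.trans hle, h5.trans hle⟩
  -- the simulating machine and its word-size constant
  obtain ⟨G, hG⟩ : ∃ G : ℕ, G = ⌈max C 0⌉₊ + ⌈α * (1 - δ)⌉₊ * K + 2 := ⟨_, rfl⟩
  obtain ⟨c₁, hc₁⟩ : ∃ c₁ : ℕ, c₁ = G + Co + k + Program.maxConst M + 2 := ⟨_, rfl⟩
  obtain ⟨k', hk'⟩ : ∃ k' : ℕ, k' = kB * c₁ + Program.maxConst MB + c₁ + G + 11 := ⟨_, rfl⟩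
  have key := sim_instance hdet hBdet hBof hC' hCB' hK hs hsT hOlen hAout hred hG hc₁ hk'
  -- growth rates
  obtain ⟨η, hηdef⟩ : ∃ η : ℝ, η = min δ 1 / 2 := ⟨_, rfl⟩
  have hη : 0 < η := by rw [hηdef]; positivity
  obtain ⟨D, hD0, hD⟩ := exists_size_le_rpow hη
  obtain ⟨ε', hε', R, hR, hgrow⟩ := exists_subExponent hCw hK hδL hδ hη
    (by rw [hηdef]; linarith [min_le_left δ 1]) (by rw [hηdef]; linarith [min_le_right δ 1])
  -- the constant
  obtain ⟨u, hu⟩ : ∃ u : ℝ, u = (2 * ((k' : ℝ) * max Cw 0)) ^ η := ⟨_, rfl⟩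
  have hu0 : 0 ≤ u := by rw [hu]; exact Real.rpow_nonneg (by positivity) _
  obtain ⟨Γ, hΓ⟩ : ∃ Γ : ℝ, Γ = (20 + 6 * (CoA : ℝ)) * (2 * max CL 0) +
      20 * ((1 + max C 0) * (2 * (D * u) + D) + max C 0 * (D * u) + max C 0 * (D * u + D)) +
      (135 + 32 * (Co : ℝ) + 114 * max CB 0) * (2 * max C 0) + (615 + 6 * (CoA : ℝ)) + 1 :=
    ⟨_, rfl⟩
  have hΓ0 : 0 ≤ Γ := by rw [hΓ]; positivity
  refine ⟨ε', hε', Γ * (R + 1), Inline.SIM M k MB kB, k', Inline.SIM_isDeterministic M k MB kB,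
    Inline.SIM_isOracleFree M k MB kB, fun x => ?_⟩
  obtain ⟨out, hout, hT⟩ := key x
  refine ⟨out, hout, hT _ ?_⟩
  -- the cost estimate on `x`
  have hP0 : 0 ≤ (A.size x : ℝ) ^ (α - ε') := Real.rpow_nonneg (Nat.cast_nonneg _) _
  obtain ⟨Y, hY⟩ : ∃ Y : ℝ, Y = (A.size x : ℝ) ^ (α - ε') + R + 1 := ⟨_, rfl⟩
  have hY1 : 1 ≤ Y := by rw [hY]; linarith
  have hgx := hgrow x
  have hnα : 0 ≤ (A.size x : ℝ) ^ α := Real.rpow_nonneg (Nat.cast_nonneg _) _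
  have e1 : ((A.size x : ℝ) ^ α) ^ (1 - δL) = (A.size x : ℝ) ^ (α * (1 - δL)) :=
    (Real.rpow_mul (Nat.cast_nonneg _) _ _).symm
  have e2 : ((A.size x : ℝ) ^ α) ^ (1 - δ) = (A.size x : ℝ) ^ (α * (1 - δ)) :=
    (Real.rpow_mul (Nat.cast_nonneg _) _ _).symm
  have e3 : ((A.size x : ℝ) ^ α) ^ η = (A.size x : ℝ) ^ (α * η) :=
    (Real.rpow_mul (Nat.cast_nonneg _) _ _).symm
  have hX1 : ((A.size x : ℝ) ^ α) ^ (1 - δL) ≤ Y := by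
    rw [e1, hY]; linarith [hgx (α * (1 - δL)) (by simp)]
  have hX2 : ((A.size x : ℝ) ^ α) ^ (1 - δ) ≤ Y := by
    rw [e2, hY]; linarith [hgx (α * (1 - δ)) (by simp)]
  have hX3 : ((A.size x : ℝ) ^ α) ^ η ≤ Y := by
    rw [e3, hY]; linarith [hgx (α * η) (by simp)]
  have hX4 : ((A.size x : ℝ) ^ α) ^ η * ((A.size x : ℝ) ^ α) ^ (1 - δ) ≤ Y := by
    rw [e2, e3, hY]
    have := rpow_natCast_mul_rpow_le (A.size x) (α * η) (α * (1 - δ))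
    linarith [hgx (α * η + α * (1 - δ)) (by simp)]
  have hX20 : 0 ≤ ((A.size x : ℝ) ^ α) ^ (1 - δ) := Real.rpow_nonneg hnα _
  -- the input length
  have hL : ((A.encode x).length : ℝ) ≤ max CL 0 * ((A.size x : ℝ) ^ α) ^ (1 - δL) + max CL 0 :=
    affine_le_affine_max (hCL x) (Real.rpow_nonneg hnα _)
  -- the width and the bit size of the target word size
  have hw : (A.width x : ℝ) ≤ max Cw 0 * (A.size x : ℝ) ^ α + max Cw 0 :=
    affine_le_affine_max (hCw x) hnα
  have hsW : (Nat.size (k' * A.width x) : ℝ) ≤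
      D * u * ((A.size x : ℝ) ^ α) ^ η + (D * u + D) := by
    have h1 := hD (k' * A.width x)
    have h2 : ((k' * A.width x : ℕ) : ℝ) ≤
        (k' : ℝ) * max Cw 0 * (A.size x : ℝ) ^ α + (k' : ℝ) * max Cw 0 := by
      push_cast
      have := mul_le_mul_of_nonneg_left hw (Nat.cast_nonneg k')
      linarith
    have h3 : ((k' * A.width x : ℕ) : ℝ) ^ η ≤
        ((k' : ℝ) * max Cw 0 * (A.size x : ℝ) ^ α + (k' : ℝ) * max Cw 0) ^ η :=
      Real.rpow_le_rpow (Nat.cast_nonneg _) h2 hη.le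
    have h4 := rpow_affine_le (C := (k' : ℝ) * max Cw 0) (a := (A.size x : ℝ) ^ α) (η := η)
      (by positivity) hnα hη.le
    rw [← hu] at h4
    have h6 := mul_le_mul_of_nonneg_left (h3.trans h4) hD0
    linarith
  -- assembling
  have hcost := sim_cost_le_linear (Nat.cast_nonneg CoA) (Nat.cast_nonneg Co) hCB' hC' hCL' hD0 hu0
    hX20 hY1 hX1 hX2 hX3 hX4 hL hsW
  rw [← hΓ] at hcost
  have hfloor : Γ * Y ≤
      ((⌊Γ * (R + 1) * (A.size x : ℝ) ^ (α - ε') + Γ * (R + 1)⌋₊ : ℕ) : ℝ) + 1 := by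
    have h1 := Nat.lt_floor_add_one (Γ * (R + 1) * (A.size x : ℝ) ^ (α - ε') + Γ * (R + 1))
    have h2 : Γ * Y ≤ Γ * (R + 1) * (A.size x : ℝ) ^ (α - ε') + Γ * (R + 1) := by
      have h3 : 0 ≤ Γ * R * (A.size x : ℝ) ^ (α - ε') := mul_nonneg (mul_nonneg hΓ0 hR) hP0
      have h4 : Γ * (R + 1) * (A.size x : ℝ) ^ (α - ε') + Γ * (R + 1) - Γ * Y =
          Γ * R * (A.size x : ℝ) ^ (α - ε') := by rw [hY]; ring
      linarith
    linarith
  linarith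

/-! ## Unconditional forms of the dependents of the transfer property -/

/-- **Transfer of truly sub-polynomial algorithms along a fine-grained reduction** (VVW ICM 2018,
the remark after Def. 2.1), unconditional form of `FGReducible.trulySubTime_of_sizeFitsWord`:
`(A, n^α) ≤_FG (B, n^β)`, `B` truly sub-`n^β`, both well formed, `A.SizeFitsWord` ⟹ `A` truly
sub-`n^α`. [cite: VassilevskaWilliamsICM2018, Def. 2.1 and the remark following it] -/
theorem FGReducible.transfer_trulySubTime {A B : FGProblem} {α β : ℝ}
    (h : FGReducible A (fun n => (n : ℝ) ^ α) B (fun n => (n : ℝ) ^ β)) (hB : B.TrulySubTime β)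
    (hA : A.IsStandard fun n => (n : ℝ) ^ α) (hB' : B.IsStandard fun n => (n : ℝ) ^ β)
    (hsz : A.SizeFitsWord) : A.TrulySubTime α :=
  FGReducible.trulySubTime_of_sizeFitsWord_holds h hB hA hB' hsz

/-- Unconditional corrected form of the primed restatement `FGReducible.trulySubTime'` (budgets
given as propositional equalities `a = (· ^ α)`, `b = (· ^ β)`): the vendored
`FGReducible.trulySubTime'` is misstated in this model together with `FGReducible.trulySubTime`
(nothing ties `A.size` to the word width; see the correction section of
`Literature.Computability.Cryptography.FGComplexity`), its corrected form
`FGReducible.trulySubTime'_of_sizeFitsWord` carries the extra hypothesis `A.SizeFitsWord` (in print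
automatic: Def. 2.1 measures time "on inputs of length `n`" with `Θ(log n)`-bit words), and here
that corrected form is fed the proved transfer property
`FGReducible.trulySubTime_of_sizeFitsWord_holds`.
[cite: VassilevskaWilliamsICM2018, Def. 2.1 and the remark following it] -/
theorem FGReducible.trulySubTime'_of_sizeFitsWord_holds {A B : FGProblem} {a b : ℕ → ℝ}
    {α β : ℝ} (h : FGReducible A a B b) (hB : B.TrulySubTime β) (hA : A.IsStandard a)
    (hB' : B.IsStandard b) (hsz : A.SizeFitsWord) (hb : b = fun n : ℕ => (n : ℝ) ^ β)
    (ha : a = fun n : ℕ => (n : ℝ) ^ α) : A.TrulySubTime α :=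
  FGReducible.trulySubTime'_of_sizeFitsWord FGReducible.trulySubTime_of_sizeFitsWord_holds h hB hA
    hB' hsz hb ha

/-- Under a subcubic equivalence of well-formed problems whose size measures fit in a word, `A` is
truly subcubic iff `B` is — unconditional form of
`SubcubicEquivalent.trulySubTime_iff_of_sizeFitsWord` (VW–W J. ACM 2018, the defining property).
[cite: VassilevskaWilliamsICM2018, Def. 2.1 and the remark following it] -/
theorem SubcubicEquivalent.trulySubTime_iff_of_sizeFitsWord_holds {A B : FGProblem}
    (h : SubcubicEquivalent A B) (hA : A.IsStandard fun n => (n : ℝ) ^ (3 : ℝ))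
    (hB : B.IsStandard fun n => (n : ℝ) ^ (3 : ℝ)) (hAs : A.SizeFitsWord)
    (hBs : B.SizeFitsWord) : A.TrulySubTime 3 ↔ B.TrulySubTime 3 :=
  h.trulySubTime_iff_of_sizeFitsWord FGReducible.trulySubTime_of_sizeFitsWord_holds hA hB hAs hBs

/-- Under a subquadratic equivalence of well-formed problems whose size measures fit in a word,
`A` is truly subquadratic iff `B` is — unconditional form of
`SubquadraticEquivalent.trulySubTime_iff_of_sizeFitsWord`.
[cite: VassilevskaWilliamsICM2018, Def. 2.1 and the remark following it] -/
theorem SubquadraticEquivalent.trulySubTime_iff_of_sizeFitsWord_holds {A B : FGProblem}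
    (h : SubquadraticEquivalent A B) (hA : A.IsStandard fun n => (n : ℝ) ^ (2 : ℝ))
    (hB : B.IsStandard fun n => (n : ℝ) ^ (2 : ℝ)) (hAs : A.SizeFitsWord)
    (hBs : B.SizeFitsWord) : A.TrulySubTime 2 ↔ B.TrulySubTime 2 :=
  h.trulySubTime_iff_of_sizeFitsWord FGReducible.trulySubTime_of_sizeFitsWord_holds hA hB hAs hBs

/-- Two families of well-formed problems reducible to each other (budget `n ^ γ`, sizes fitting in
a word) are all truly sub-`n^γ` or none is — unconditional form of
`trulySubTime_iff_of_family_of_sizeFitsWord` (VW–W J. ACM 2018, Thm. 1.1 pattern).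
[cite: VassilevskaWilliamsICM2018, Def. 2.1 and the remark following it] -/
theorem trulySubTime_iff_of_family_of_sizeFitsWord_holds {ι κ : Type} {A : ι → FGProblem}
    {B : κ → FGProblem} {γ : ℝ}
    (hAB : ∀ i, ∃ j, FGReducible (A i) (fun n => (n : ℝ) ^ γ) (B j) (fun n => (n : ℝ) ^ γ))
    (hBA : ∀ j, ∃ i, FGReducible (B j) (fun n => (n : ℝ) ^ γ) (A i) (fun n => (n : ℝ) ^ γ))
    (hA : ∀ i, (A i).IsStandard fun n => (n : ℝ) ^ γ)
    (hB : ∀ j, (B j).IsStandard fun n => (n : ℝ) ^ γ)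
    (hAs : ∀ i, (A i).SizeFitsWord) (hBs : ∀ j, (B j).SizeFitsWord) :
    (∀ i, (A i).TrulySubTime γ) ↔ ∀ j, (B j).TrulySubTime γ :=
  trulySubTime_iff_of_family_of_sizeFitsWord FGReducible.trulySubTime_of_sizeFitsWord_holds
    hAB hBA hA hB hAs hBs


/-! ## Monotonicity of the randomised running-time predicates

The randomised analogues of `FGProblem.InTimeInst.mono`, `InTime.mono`, `InTime.inTimeO` and
`InTimeO.mono` of the statement file, from the monotonicity of the success probability in the
time bound (`WordRAM.successProb_mono_steps`: a run of at most `t` steps reads at most `t`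
coins, so extending the time bound can only enlarge the success event); plus restriction to a
sub-family of instances and weakening of the success threshold. -/

namespace FGProblem

/-- Monotonicity of `RandInTimeInst` in the time bound. [folklore] -/
theorem RandInTimeInst.mono {P : FGProblem} {T T' : P.Inst → ℕ} {σ : ℝ}
    (h : P.RandInTimeInst T σ) (hT : ∀ a, T a ≤ T' a) : P.RandInTimeInst T' σ := by
  obtain ⟨M, k, ho, hM⟩ := h
  exact ⟨M, k, ho, fun a => (hM a).trans (successProb_mono_steps M _ noOracle _ _ (hT a))⟩

/-- Weakening the success threshold of `RandInTimeInst`. [folklore] -/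
theorem RandInTimeInst.of_le {P : FGProblem} {T : P.Inst → ℕ} {σ σ' : ℝ}
    (h : P.RandInTimeInst T σ) (hσ : σ' ≤ σ) : P.RandInTimeInst T σ' := by
  obtain ⟨M, k, ho, hM⟩ := h
  exact ⟨M, k, ho, fun a => hσ.trans (hM a)⟩

/-- Randomised per-instance time bounds descend to restrictions (same program, same encoding,
size and accepted outputs). [folklore] -/
theorem RandInTimeInst.restrict {P : FGProblem} {T : P.Inst → ℕ} {σ : ℝ}
    (h : P.RandInTimeInst T σ) (S : Set P.Inst) :
    (P.restrict S).RandInTimeInst (fun a => T a.1) σ := by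
  obtain ⟨M, k, ho, hM⟩ := h
  exact ⟨M, k, ho, fun a => hM a.1⟩

/-- Monotonicity of `RandInTime` in the time bound. [folklore] -/
theorem RandInTime.mono {P : FGProblem} {T T' : ℕ → ℝ} (h : P.RandInTime T)
    (hT : ∀ n, T n ≤ T' n) : P.RandInTime T' :=
  RandInTimeInst.mono h fun _ => Nat.floor_le_floor (hT _)

/-- Randomised time `T` is randomised time `O(T)`. [folklore] -/
theorem RandInTime.randInTimeO {P : FGProblem} {T : ℕ → ℝ} (h : P.RandInTime T) :
    P.RandInTimeO T :=
  ⟨1, h.mono fun n => by linarith⟩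

/-- Monotonicity of `RandInTimeO` in the time bound (pointwise, for nonnegative bounds). [folklore] -/
theorem RandInTimeO.mono {P : FGProblem} {t t' : ℕ → ℝ} (h : P.RandInTimeO t) (ht : ∀ n, 0 ≤ t n)
    (htt' : ∀ n, t n ≤ t' n) : P.RandInTimeO t' := by
  obtain ⟨C, hC⟩ := h
  refine ⟨max C 0, hC.mono fun n => ?_⟩
  have h1 : C * t n ≤ max C 0 * t n := mul_le_mul_of_nonneg_right (le_max_left _ _) (ht n)
  have h2 : max C 0 * t n ≤ max C 0 * t' n :=
    mul_le_mul_of_nonneg_left (htt' n) (le_max_right _ _)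
  linarith [le_max_left C 0]

/-- Randomised running-time bounds `O(t)` descend to restrictions. [folklore] -/
theorem RandInTimeO.restrict {P : FGProblem} {t : ℕ → ℝ} (h : P.RandInTimeO t) (S : Set P.Inst) :
    (P.restrict S).RandInTimeO t := by
  obtain ⟨C, M, k, ho, hM⟩ := h
  exact ⟨C, M, k, ho, fun a => hM a.1⟩

/-- Randomised truly sub-`n^c` implies randomised truly sub-`n^{c'}` for `c ≤ c'` (by rewriting
the exponent, as for `TrulySubTime.mono`). [folklore] -/
theorem RandTrulySubTime.mono {P : FGProblem} {c c' : ℝ} (h : P.RandTrulySubTime c)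
    (hc : c ≤ c') : P.RandTrulySubTime c' := by
  obtain ⟨ε, hε, hP⟩ := h
  refine ⟨ε + (c' - c), by linarith, ?_⟩
  have : (fun n : ℕ => (n : ℝ) ^ (c' - (ε + (c' - c)))) = fun n : ℕ => (n : ℝ) ^ (c - ε) := by
    funext n; congr 1; ring
  rw [this]
  exact hP

end FGProblem

end Literature.Computability.Cryptography
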